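import Mathlib
import HarnessLib
import Literature.Probability.LatticeModels.TorusFourierWeightedL1
import Literature.Probability.LatticeModels.TorusInverseQuadraticWeightSum

/-!
# Route `KLProgramme` — crux K3, VL child (stmt-HubbardSuperconductivity-20440), located item «VL-BASE-DEFECT» / keying option «(VL)-SRC-WINDOW»:
# THE `ℓ¹` NORM OF A WINDOWED ONE-DIMENSIONAL CHARACTER SUM IS `O(P^{1/2}·(‖h‖₂² + (P/4)²‖Δh‖₂²)^{1/2})`
# (seat hubbard-kl-k3c4-p1 g16; `--supports` 20440)

«BASE-SRC-ROWS» (p3 g18, p641676): the plain source block of the base transfer is the HALF-RANGE Dirichlet kernel on the `4M` time grid, whose `ℓ¹` norm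
is `≍ ln M`.  A source read through a SMOOTH FREQUENCY WINDOW `w_j = χ((j − M)/M)` (≡ 1 on the inner half of the band, so the END read-out at any fixed
Matsubara integer is untouched once `M` is large) replaces it by the windowed kernel `d ↦ Σ_j w_j χ_j(d)`, and the present lemma is the estimate that makes
its `ℓ¹` norm `O(M)` (hence the `ε`-scaled rows `O(1)`, `M`-uniform): the weighted-Plancherel route of `Literature…TorusFourierWeightedL1.sum_norm_sum_torusChar_le`
in dimension one with ONE first difference, paid by `Σ_x (1 + x̃²)⁻¹ ≤ 2 + π` (`…TorusInverseQuadraticWeightSum.sum_zmod_inv_one_add_sq_valMinAbs_le`).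

* **`sum_norm_charSum_one_le_of_fwdDiff`** — on `(ℤ/Pℤ)¹`: `Σ_x ‖Σ_k χ_k(x) h(k)‖ ≤ √(2 + π) · √(P · (Σ_k ‖h k‖² + (P/4)² · Σ_k ‖(Δ₁ h) k‖²))`;
* `sum_norm_charSum_one_le_of_bounds` — the same from a support count `Ns`, a sup `A` and a first-difference sup `D·(4/P)`:
  `≤ √(2 + π) · √(P · (Ns·A² + Nd·D²))` (`Nd` = support count of the difference).
For the window (`P = 4M`, `Ns ≤ 2M`, `Nd ≤ 2M + 1`, `A = 1`, `D = 4‖χ′‖_∞`): `≤ √(2+π)·√(4M·(2M + (2M+1)·16‖χ′‖²)) = O(M)`.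

Proofs only; no definition.  Pure torus Fourier analysis; nothing about the Hubbard model is asserted.
[cite: BenfattoGiulianiMastropietro2006, Lemma 2.2 and footnote 1]
-/

noncomputable section

namespace Summit.HubbardSuperconductivity.HubbardSuperconductivity.Theorems.TwoVolumeSource

set_option linter.dupNamespace false -- summit = problem name (single-conjunct summit), D-0017

open Finset Complex Literature.Probability.LatticeModels
open scoped Real

/-- On the one-dimensional torus the additive weight of `sum_norm_sum_torusChar_le` with the single direction `1`, one difference and coefficient
`(P/4)²` is `1 + x̃²`. [folklore] -/
theorem one_add_weight_eq {P : ℕ} [NeZero P] (x : TorusSite 1 P) :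
    (1 + ∑ i ∈ ({()} : Finset Unit), ((P : ℝ) / 4) ^ 2 * (4 * |((∑ j, (fun (_ : Unit) (_ : Fin 1) => (1 : ZMod P)) i j * x j).valMinAbs : ℝ)| / P) ^ (2 * 1)) =
      1 + (1 * |(((x 0).valMinAbs : ℤ) : ℝ)|) ^ 2 := by
  have hP : (0 : ℝ) < P := Nat.cast_pos.2 (Nat.pos_of_ne_zero (NeZero.ne P))
  simp only [sum_singleton, Fin.sum_univ_one, one_mul, mul_one]
  rw [div_pow, div_pow, mul_pow]
  field_simp

/-- `Σ_{x : TorusSite 1 P} (1 + x̃²)⁻¹ ≤ 2 + π` (transport of `sum_zmod_inv_one_add_sq_valMinAbs_le` along `TorusSite 1 P ≃ ZMod P`). [folklore] -/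
theorem sum_torusSite_one_inv_one_add_sq_le (P : ℕ) [NeZero P] :
    ∑ x : TorusSite 1 P, (1 + (1 * |(((x 0).valMinAbs : ℤ) : ℝ)|) ^ 2)⁻¹ ≤ 2 + Real.pi := by
  have h := sum_zmod_inv_one_add_sq_valMinAbs_le (n := P) one_pos
  rw [div_one] at h
  refine le_trans (le_of_eq ?_) h
  exact Fintype.sum_equiv (Equiv.funUnique (Fin 1) (ZMod P)) _ _ fun x => rfl

/-- **THE `ℓ¹` NORM OF A ONE-DIMENSIONAL CHARACTER SUM FROM `ℓ²` NORMS OF THE SYMBOL AND OF ITS FIRST DIFFERENCE** (see the module docstring).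
[cite: BenfattoGiulianiMastropietro2006, Lemma 2.2 and footnote 1] -/
theorem sum_norm_charSum_one_le_of_fwdDiff {P : ℕ} [NeZero P] (h : TorusSite 1 P → ℂ) :
    ∑ x : TorusSite 1 P, ‖∑ k, torusChar k x * h k‖ ≤
      Real.sqrt (2 + Real.pi) * Real.sqrt ((P : ℝ) * (∑ k, ‖h k‖ ^ 2 + ((P : ℝ) / 4) ^ 2 * ∑ k, ‖fwdDiff (fun _ : Fin 1 => (1 : ZMod P)) h k‖ ^ 2)) := by
  have hmain := sum_norm_sum_torusChar_le (d := 1) (L := P) ({()} : Finset Unit) (fun (_ : Unit) (_ : Fin 1) => (1 : ZMod P))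
    (fun _ => ((P : ℝ) / 4) ^ 2) (fun _ _ => by positivity) 1 h
  refine hmain.trans ?_
  have hW : ∑ x : TorusSite 1 P, (1 + ∑ i ∈ ({()} : Finset Unit),
      ((P : ℝ) / 4) ^ 2 * (4 * |((∑ j, (fun (_ : Unit) (_ : Fin 1) => (1 : ZMod P)) i j * x j).valMinAbs : ℝ)| / P) ^ (2 * 1))⁻¹ ≤ 2 + Real.pi := by
    simp_rw [one_add_weight_eq]
    exact sum_torusSite_one_inv_one_add_sq_le P
  refine mul_le_mul (Real.sqrt_le_sqrt hW) (Real.sqrt_le_sqrt (le_of_eq ?_)) (Real.sqrt_nonneg _) (Real.sqrt_nonneg _)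
  simp only [sum_singleton, pow_one, Function.iterate_one]

/-- **The same from sup / support data**: support of `h` of size `≤ Ns` with `‖h‖ ≤ A`, support of `Δ₁ h` of size `≤ Nd` with `‖Δ₁ h‖ ≤ D·(4/P)` ⇒
`Σ_x ‖Σ_k χ_k(x) h(k)‖ ≤ √(2 + π)·√(P·(Ns·A² + Nd·D²))`. [folklore] -/
theorem sum_norm_charSum_one_le_of_bounds {P : ℕ} [NeZero P] (h : TorusSite 1 P → ℂ) {A D : ℝ} {Ns Nd : ℕ}
    (hsupp : (univ.filter fun k => h k ≠ 0).card ≤ Ns) (hsup : ∀ k, ‖h k‖ ≤ A)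
    (hdsupp : (univ.filter fun k => fwdDiff (fun _ : Fin 1 => (1 : ZMod P)) h k ≠ 0).card ≤ Nd)
    (hdsup : ∀ k, ‖fwdDiff (fun _ : Fin 1 => (1 : ZMod P)) h k‖ ≤ D * (4 / P)) :
    ∑ x : TorusSite 1 P, ‖∑ k, torusChar k x * h k‖ ≤ Real.sqrt (2 + Real.pi) * Real.sqrt ((P : ℝ) * (Ns * A ^ 2 + Nd * D ^ 2)) := by
  classical
  have hP : (0 : ℝ) < P := Nat.cast_pos.2 (Nat.pos_of_ne_zero (NeZero.ne P))
  refine (sum_norm_charSum_one_le_of_fwdDiff h).trans (mul_le_mul_of_nonneg_left (Real.sqrt_le_sqrt ?_) (Real.sqrt_nonneg _))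
  refine mul_le_mul_of_nonneg_left (add_le_add ?_ ?_) hP.le
  · -- `Σ ‖h‖² ≤ Ns·A²` : only the support contributes
    have hsplit : ∑ k, ‖h k‖ ^ 2 = ∑ k ∈ univ.filter (fun k => h k ≠ 0), ‖h k‖ ^ 2 := by
      rw [sum_filter]
      refine sum_congr rfl fun k _ => ?_
      by_cases hk : h k = 0
      · simp [hk]
      · simp [hk]
    rw [hsplit]
    calc ∑ k ∈ univ.filter (fun k => h k ≠ 0), ‖h k‖ ^ 2 ≤ ∑ k ∈ univ.filter (fun k => h k ≠ 0), A ^ 2 :=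
          sum_le_sum fun k _ => pow_le_pow_left₀ (norm_nonneg _) (hsup k) 2
      _ = (univ.filter (fun k => h k ≠ 0)).card * A ^ 2 := by rw [sum_const, nsmul_eq_mul]
      _ ≤ Ns * A ^ 2 := mul_le_mul_of_nonneg_right (by exact_mod_cast hsupp) (sq_nonneg A)
  · -- `(P/4)²·Σ ‖Δh‖² ≤ Nd·D²`
    have hsplit : ∑ k, ‖fwdDiff (fun _ : Fin 1 => (1 : ZMod P)) h k‖ ^ 2 =
        ∑ k ∈ univ.filter (fun k => fwdDiff (fun _ : Fin 1 => (1 : ZMod P)) h k ≠ 0), ‖fwdDiff (fun _ : Fin 1 => (1 : ZMod P)) h k‖ ^ 2 := by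
      rw [sum_filter]
      refine sum_congr rfl fun k _ => ?_
      by_cases hk : fwdDiff (fun _ : Fin 1 => (1 : ZMod P)) h k = 0
      · simp [hk]
      · simp [hk]
    rw [hsplit]
    have hterm : ∀ k, ‖fwdDiff (fun _ : Fin 1 => (1 : ZMod P)) h k‖ ^ 2 ≤ (D * (4 / P)) ^ 2 :=
      fun k => pow_le_pow_left₀ (norm_nonneg _) (hdsup k) 2
    calc ((P : ℝ) / 4) ^ 2 * ∑ k ∈ univ.filter (fun k => fwdDiff (fun _ : Fin 1 => (1 : ZMod P)) h k ≠ 0), ‖fwdDiff (fun _ : Fin 1 => (1 : ZMod P)) h k‖ ^ 2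
        ≤ ((P : ℝ) / 4) ^ 2 * ∑ k ∈ univ.filter (fun k => fwdDiff (fun _ : Fin 1 => (1 : ZMod P)) h k ≠ 0), (D * (4 / P)) ^ 2 :=
          mul_le_mul_of_nonneg_left (sum_le_sum fun k _ => hterm k) (by positivity)
      _ = (univ.filter (fun k => fwdDiff (fun _ : Fin 1 => (1 : ZMod P)) h k ≠ 0)).card * D ^ 2 := by
          rw [sum_const, nsmul_eq_mul]; field_simp
      _ ≤ Nd * D ^ 2 := mul_le_mul_of_nonneg_right (by exact_mod_cast hdsupp) (sq_nonneg D)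

end Summit.HubbardSuperconductivity.HubbardSuperconductivity.Theorems.TwoVolumeSource

end
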